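import Summits.BirchSwinnertonDyer.BirchSwinnertonDyer.Theorems.SylvesterTwoHeegnerIndexUpperConeOfPrintExactByName
import Summits.BirchSwinnertonDyer.BirchSwinnertonDyer.Theorems.SylvesterTwoHeegnerIndexHeegnerIndexUpperAtTwoHSYOfCoupledBounds
import Summits.BirchSwinnertonDyer.BirchSwinnertonDyer.Theorems.SylvesterTwoHeegnerIndexStrictSelmerBookkeeping
import HarnessLib

/-!
# Route `SylvesterTwoHeegnerIndex` (rung K7t): the ASIDE fact-free LOWER crux `HeegnerIndexLowerAtTwoHSY`
# (stmt-BirchSwinnertonDyer-19230): its registered strict-Selmer stubs read against the live LOWER children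
# `LowerOnV0HSY` (stmt-…-19891) / `LowerOffV0HSY` (stmt-…-19892), `PublishedFactsTwo(Plus)` and the named
# prints; and the rung leaf from the two LOWER children and the named prints

Seat `leafhand-bsd-sylvestertwoheegne-2` g0 (explicit unit; items 19476 / 19581 / 19230 of route
`SylvesterTwoHeegnerIndex`).  THEOREMS ONLY: compositions of landed theorems; no definition, no named
fact, no instance, no notation, no `sorry`.

WHAT THIS FILE IS.  Item 19230 `HeegnerIndexLowerAtTwoHSY` (the Gross–Zagier / main-conjecture direction
`ord₂ 𝔮 ≤ ord₂ #Ш(E_p)` in every Heegner frame on 𝒞_HSY, fact-free, ASIDE) is literally the conclusion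
of its facts-conditional twin 19477 `HeegnerIndexLowerAtTwoHSYOfFacts := PublishedFactsTwo → 19230`,
and 19477 is split LOSSLESSLY into the live children `LowerOnV0HSY` / `LowerOffV0HSY`
(`SylvesterTwoLowerSplit.lowerOfFacts_iff_onV0_and_offV0`, p471972).  Its registered skeleton
(a61a9288a4220307, seat k7t-c3 g0) has four strict-Selmer stubs; two (`stub_shaLeStrictSelmerAtTwo`,
`stub_strictSelmerLeShaAtTwo`) are landed modulo GZK (p417881), the other two are EQUIVALENT modulo GZK
to the UPPER / LOWER hand cruxes (`SylvesterTwoLower.heegnerIndexUpperAtTwoHSY_iff_strictSelmerUpper_of_GZK`,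
`…heegnerIndexLowerAtTwoHSY_iff_strictSelmerLower_of_GZK`).  This file records, BY NAME:

* §1 (pointer, nothing restated) THE ROUTE DECL of item 19230 from `PublishedFactsTwo` and the two
  live children 19891 / 19892 is already k7t-c2 g15's
  `SylvesterTwoHandItemResiduals.heegnerIndexLowerAtTwoHSY_of_facts_of_onV0_of_offV0` (reused in §2/§3);
* §2 ★ `strictSelmerUpperAtTwo_of_publishedFactsTwoPlus_of_named` — the TEXT of the registered stub
  `stub_strictSelmerUpperAtTwo` (the Kolyvagin direction in strict-Selmer currency) from
  `PublishedFactsTwoPlus` and the four named PRINT facts `{(G3′) HuShuYin2019.exists_deg_eq_six_isS3Invariant,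
  #19 HuShuYin2019.shaAnPair_mul_height_eq_two_zpow_mul_height_named, #20 Nekovar2007.cmPoint_frobeniusCongruence,
  VII casselsTate_canonical_adjoint}` (k7t-c2 g35's hand item 19229 by name,
  `SylvesterTwoUpperConePrintExact.heegnerIndexUpperAtTwoHSY_of_publishedFactsTwoPlus_of_named`, through
  the GZK iff) — zero research hypotheses; `strictSelmerLowerAtTwo_of_facts_of_parts` — the TEXT of the
  registered stub `stub_strictSelmerLowerAtTwo` from `PublishedFactsTwo` + the two live LOWER children;
* §3 ★★ `cmAtTwo_of_lowerParts_of_publishedFactsTwoPlus_of_named` — the rung leaf `X12.CMAtTwo`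
  (`BSD(E_p, 2)` on 𝒞_HSY) from EXACTLY: the two OPEN LOWER children 19891 / 19892, `PublishedFactsTwoPlus`,
  and the four named prints (g35's `cmAtTwo_of_lower_of_publishedFactsTwoPlus_of_named` ∘ §1).

READING OF RECORD (kernel-checked here): after the UPPER cone's print-only closure (k7t-c2 g34/g35 and
`…UpperAsideTwinsByName`), what the K7t rung and the aside item 19230 still need is EXACTLY the two LOWER
children `LowerOnV0HSY` (2-primitivity of Hu–Shu–Yin's point on 𝒱₀) and `LowerOffV0HSY` («extra
2-divisibility forces Ш» off 𝒱₀), plus the published facts and the displayed prints.  Of 19230's four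
registered stubs, three are conditional theorems of the tree (two modulo GZK ∈ `PublishedFactsTwo`, one
modulo `PublishedFactsTwoPlus` + prints, §2) and the fourth IS the open LOWER half (§2, iff).

HONEST LABEL: CONDITIONAL theorems — route decls of OPEN items and print facts are DISPLAYED as
hypotheses; no ledger item is closed by this file; the registered stubs of 19230 are NOT closed by name;
`X12.CMAtTwo` is NOT proved; BSD is proved for no curve, by none of this.

## References
* Y. Hu, J. Shu, H. Yin, Trans. AMS 372 (2019) = arXiv:1708.05266: Thm. 1.3/1.4, Prop. 2.1 (1), Cor. 4.4,
  display (bsd) p. 12, §4.1. [HuShuYin2019]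
* B. H. Gross, D. Zagier, Invent. Math. 84 (1986), I (6.5), V §2. [GrossZagier1986]
* V. A. Kolyvagin, *Euler systems* (1990), Thm. A. [Kolyvagin1990]
* R. Greenberg, LNM 1716 (1999), §2 (pp. 62–63). [GreenbergLNM1716]
* R. L. Miller, LMS J. Comput. Math. 14 (2011), §1, Def. 1.1. [Miller2011LMS]
* J. Nekovář (2007), Prop. 4.9. [Nekovar2007]  · J. S. Milne, ADT (2006), I §6. [MilneADT2006]
-/

set_option linter.dupNamespace false -- Summits modules are `Summit.<Summit>.<Problem>…` by design
set_option autoImplicit false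

noncomputable section

open scoped Classical

open WeierstrassCurve
open Literature.NumberTheory.EllipticCurves Literature.NumberTheory.EllipticCurves.ModularForms
  Literature.NumberTheory.EllipticCurves.HuShuYin2019
  Literature.NumberTheory.EllipticCurves.Rank1Residual.Typed
open Summit.BirchSwinnertonDyer.BirchSwinnertonDyer.Theses.SylvesterTwoHeegnerIndex
  hiding HSYPointTwoDivisibleSevenModNine
open Summit.BirchSwinnertonDyer.BirchSwinnertonDyer.Theorems
  Summit.BirchSwinnertonDyer.BirchSwinnertonDyer.Theorems.SylvesterTwoUpperConePrintExact

namespace Summit.BirchSwinnertonDyer.BirchSwinnertonDyer.Theorems.SylvesterTwoLowerAsideTwin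

/-! ## §1 The aside LOWER crux 19230 BY NAME from the facts and the live LOWER cone — ALREADY IN THE TREE

Item 19230 ⟸ items 19231 `PublishedFactsTwo` + 19891 `LowerOnV0HSY` + 19892 `LowerOffV0HSY` is k7t-c2 g15's
`SylvesterTwoHandItemResiduals.heegnerIndexLowerAtTwoHSY_of_facts_of_onV0_of_offV0`
(`Theorems/SylvesterTwoHeegnerIndexHeegnerIndexUpperAtTwoHSYOfCoupledBounds.lean`, the term of k7t-c3's
lossless split `SylvesterTwoLowerSplit.lowerOfFacts_of_onV0_of_offV0`, p471972); it is REUSED below, not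
restated. -/

/-! ## §2 The registered strict-Selmer stubs of 19230's skeleton (a61a9288a4220307) against the cone -/

/-- ★ **The TEXT of the registered stub `stub_strictSelmerUpperAtTwo` ⟸ `PublishedFactsTwoPlus` + the four
named PRINT facts `{(G3′), #19, #20, VII}`**: `ord₂ #Sel_str(E_p)[2^∞] ≤ n + ord₂ 𝔮` in every Heegner frame
(`2^n ∥ P₀` in `E_p(ℚ₂)`), from k7t-c2 g35's hand item 19229 by name
(`heegnerIndexUpperAtTwoHSY_of_publishedFactsTwoPlus_of_named`) through k7t-c3's GZK iff
(`SylvesterTwoLower.heegnerIndexUpperAtTwoHSY_iff_strictSelmerUpper_of_GZK`; GZK is conjunct 8 of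
`PublishedFactsTwo`).  Zero research hypotheses.  CONDITIONAL; the stub is not closed by name; BSD is
proved for no curve. [cite: HuShuYin2019, Thm. 1.4, Prop. 2.1 (1), Cor. 4.4, display (bsd) p. 12, §4.1]
[cite: Nekovar2007, Prop. 4.9] [cite: MilneADT2006, Ch. I §6 Prop. 6.9, Thm. 6.13(a)]
[cite: GreenbergLNM1716, §2 (pp. 62–63)] [cite: Kolyvagin1990, Thm. A] -/
theorem strictSelmerUpperAtTwo_of_publishedFactsTwoPlus_of_named (hF : PublishedFactsTwoPlus)
    (hG3' : exists_deg_eq_six_isS3Invariant)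
    (hD : shaAnPair_mul_height_eq_two_zpow_mul_height_named) (hES2 : Nekovar2007.cmPoint_frobeniusCongruence)
    (hVII : ∀ (K : Type) [Field K] [NumberField K] (σ₀ : K ≃ₐ[ℚ] K) (h2 : Module.finrank ℚ K = 2)
      (hσ₀ : σ₀ ≠ 1), casselsTate_canonical_adjoint K σ₀ h2 hσ₀) :
    ∀ (p : ℕ), p.Prime → (p % 9 = 4 ∨ p % 9 = 7) → (¬ ∃ x : ZMod p, x ^ 3 = 3) → ∀ (W : WeierstrassCurve ℚ) [W.IsElliptic] [W.IsGloballyMinimal], (∃ C : WeierstrassCurve.VariableChange ℚ, C • W = Literature.NumberTheory.EllipticCurves.HuShuYin2019.cubeSumCurve (p : ℚ)) → ∀ (N : ℕ) [NeZero N] (K : Type) [Field K] [NumberField K] (Dt : Literature.NumberTheory.EllipticCurves.ModularForms.ModularParametrizationData W N) (H : Literature.NumberTheory.EllipticCurves.HeegnerDatum N (NumberField.discr K)) (ι : K →+* ℂ) (P : (W.baseChange K).toAffine.Point) (Wd : WeierstrassCurve ℚ) [Wd.IsElliptic] [Wd.IsGloballyMinimal] (Cd : WeierstrassCurve.VariableChange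 ℚ) (k : ℕ), W.HasCM → W.analyticRank = 1 → Literature.NumberTheory.EllipticCurves.IsImaginaryQuadratic K → Literature.NumberTheory.EllipticCurves.SatisfiesHeegnerHypothesis N K → WeierstrassCurve.Affine.Point.map ι.toRatAlgHom P = Literature.NumberTheory.EllipticCurves.ModularForms.heegnerPointComplex Dt H → (W.quadraticTwist (NumberField.discr K : ℚ)).entireLFunction 1 ≠ 0 → Cd • W.quadraticTwist (NumberField.discr K : ℚ) = Wd → (k = 1 ∨ k = 2) → (k = 2 ↔ ∀ y : W.toAffine.Point, ∃ Q : (W.baseChange K).toAffine.Point, WeierstrassCurve.QuadraticDescent.incl K W y - (2 : ℤ) • Q ∈ AddCommGroup.torsion (W.baseChange K).toAffine.Point) → ∀ (P₀ : W.toAffine.Point) (n : ℕ), ¬ IsOfFinAddOrder P₀ → (∀ R : W.toAffine.Point, ∃ (m : ℤ) (T : W.toAffine.Point), IsOfFinAddOrder T ∧ R = m • P₀ + T) → (∀ Q : (W.baseChange ℚ_[2]).toAffine.Point, 2 • Q = 0 → Q = 0) → (∃ Q : (W.baseChange ℚ_[2]).toAffine.Point, 2 ^ n • Q = W.toPadicPoint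 2 P₀) → (∀ Q : (W.baseChange ℚ_[2]).toAffine.Point, 2 ^ (n + 1) • Q ≠ W.toPadicPoint 2 P₀) → (padicValNat 2 (Nat.card ↥(Summit.BirchSwinnertonDyer.Rank1Residual.Additive.strictSelmerPInfty W 2)) : ℤ) ≤ (n : ℤ) + padicValRat 2 (Summit.BirchSwinnertonDyer.Rank1Residual.P2.cmHeegnerIndexQuotient W K P Dt.c k Wd Cd.u) :=
  (SylvesterTwoLower.heegnerIndexUpperAtTwoHSY_iff_strictSelmerUpper_of_GZK hF.1.2.2.2.2.2.2.2.1).mp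
    (heegnerIndexUpperAtTwoHSY_of_publishedFactsTwoPlus_of_named hF hG3' hD hES2 hVII)

/-- **The TEXT of the registered stub `stub_strictSelmerLowerAtTwo` ⟸ `PublishedFactsTwo` + the two live
LOWER children 19891 / 19892**: `n + ord₂ 𝔮 ≤ ord₂ #Sel_str(E_p)[2^∞]` in every Heegner frame, from k7t-c2 g15's
`SylvesterTwoHandItemResiduals.heegnerIndexLowerAtTwoHSY_of_facts_of_onV0_of_offV0` through k7t-c3's GZK iff
(`SylvesterTwoLower.heegnerIndexLowerAtTwoHSY_iff_strictSelmerLower_of_GZK`).  By that iff this stub IS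
the open LOWER half modulo GZK; nothing is asserted about the children.  CONDITIONAL; the stub is not
closed by name; BSD is proved for no curve. [cite: GreenbergLNM1716, §2 (pp. 62–63)]
[cite: Miller2011LMS, §1 and Def. 1.1] [cite: HuShuYin2019, Thm. 1.3 / 1.4 (p. 3)] -/
theorem strictSelmerLowerAtTwo_of_facts_of_parts (hF : PublishedFactsTwo) (hon : LowerOnV0HSY)
    (hoff : LowerOffV0HSY) :
    ∀ (p : ℕ), p.Prime → (p % 9 = 4 ∨ p % 9 = 7) → (¬ ∃ x : ZMod p, x ^ 3 = 3) → ∀ (W : WeierstrassCurve ℚ) [W.IsElliptic] [W.IsGloballyMinimal], (∃ C : WeierstrassCurve.VariableChange ℚ, C • W = Literature.NumberTheory.EllipticCurves.HuShuYin2019.cubeSumCurve (p : ℚ)) → ∀ (N : ℕ) [NeZero N] (K : Type) [Field K] [NumberField K] (Dt : Literature.NumberTheory.EllipticCurves.ModularForms.ModularParametrizationData W N) (H : Literature.NumberTheory.EllipticCurves.HeegnerDatum N (NumberField.discr K)) (ι : K →+* ℂ) (P : (W.baseChange K).toAffine.Point) (Wd : WeierstrassCurve ℚ) [Wd.IsElliptic]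 [Wd.IsGloballyMinimal] (Cd : WeierstrassCurve.VariableChange ℚ) (k : ℕ), W.HasCM → W.analyticRank = 1 → Literature.NumberTheory.EllipticCurves.IsImaginaryQuadratic K → Literature.NumberTheory.EllipticCurves.SatisfiesHeegnerHypothesis N K → WeierstrassCurve.Affine.Point.map ι.toRatAlgHom P = Literature.NumberTheory.EllipticCurves.ModularForms.heegnerPointComplex Dt H → (W.quadraticTwist (NumberField.discr K : ℚ)).entireLFunction 1 ≠ 0 → Cd • W.quadraticTwist (NumberField.discr K : ℚ) = Wd → (k = 1 ∨ k = 2) → (k = 2 ↔ ∀ y : W.toAffine.Point, ∃ Q : (W.baseChange K).toAffine.Point, WeierstrassCurve.QuadraticDescent.incl K W y - (2 : ℤ) • Q ∈ AddCommGroup.torsion (W.baseChange K).toAffine.Point) → ∀ (P₀ : W.toAffine.Point) (n : ℕ), ¬ IsOfFinAddOrder P₀ → (∀ R : W.toAffine.Point, ∃ (m : ℤ) (T : W.toAffine.Point), IsOfFinAddOrder T ∧ R = m • P₀ + T) → (∀ Q : (W.baseChange ℚ_[2]).toAffine.Point, 2 • Q = 0 → Q = 0) → (∃ Q : (W.baseChange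 ℚ_[2]).toAffine.Point, 2 ^ n • Q = W.toPadicPoint 2 P₀) → (∀ Q : (W.baseChange ℚ_[2]).toAffine.Point, 2 ^ (n + 1) • Q ≠ W.toPadicPoint 2 P₀) → (n : ℤ) + padicValRat 2 (Summit.BirchSwinnertonDyer.Rank1Residual.P2.cmHeegnerIndexQuotient W K P Dt.c k Wd Cd.u) ≤ (padicValNat 2 (Nat.card ↥(Summit.BirchSwinnertonDyer.Rank1Residual.Additive.strictSelmerPInfty W 2)) : ℤ) :=
  (SylvesterTwoLower.heegnerIndexLowerAtTwoHSY_iff_strictSelmerLower_of_GZK hF.2.2.2.2.2.2.2.1).mp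
    (SylvesterTwoHandItemResiduals.heegnerIndexLowerAtTwoHSY_of_facts_of_onV0_of_offV0 hF hon hoff)

/-! ## §3 The rung leaf from the two LOWER children, the facts and the named prints -/

/-- ★★ **The rung leaf `X12.CMAtTwo` (`BSD(E_p, 2)` on 𝒞_HSY) ⟸ EXACTLY: the two OPEN LOWER children
`LowerOnV0HSY` (19891) / `LowerOffV0HSY` (19892), `PublishedFactsTwoPlus`, and the four named PRINT facts
`{(G3′), #19, #20, VII}`** — k7t-c2 g35's `cmAtTwo_of_lower_of_publishedFactsTwoPlus_of_named` (closed
Assembly 19232 on the UPPER cone from the prints) with the LOWER half supplied by k7t-c2 g15's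
`heegnerIndexLowerAtTwoHSY_of_facts_of_onV0_of_offV0` (§1).  READING OF
RECORD: after the print-only closure of the UPPER cone, the K7t rung needs the two LOWER children and
nothing else that is not a published fact.  CONDITIONAL; nothing is asserted about the LOWER children;
`X12.CMAtTwo` is NOT proved; BSD is proved for no curve, by none of this.
[cite: GrossZagier1986, I (6.5), V §2] [cite: HuShuYin2019, Thm. 1.4, Prop. 2.1 (1), Cor. 4.4, §4.1]
[cite: Kolyvagin1990, Thm. A] [cite: Nekovar2007, Prop. 4.9] [cite: MilneADT2006, Ch. I §6 Prop. 6.9, Thm. 6.13(a)] -/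
theorem cmAtTwo_of_lowerParts_of_publishedFactsTwoPlus_of_named (hon : LowerOnV0HSY) (hoff : LowerOffV0HSY)
    (hF : PublishedFactsTwoPlus) (hG3' : exists_deg_eq_six_isS3Invariant)
    (hD : shaAnPair_mul_height_eq_two_zpow_mul_height_named) (hES2 : Nekovar2007.cmPoint_frobeniusCongruence)
    (hVII : ∀ (K : Type) [Field K] [NumberField K] (σ₀ : K ≃ₐ[ℚ] K) (h2 : Module.finrank ℚ K = 2)
      (hσ₀ : σ₀ ≠ 1), casselsTate_canonical_adjoint K σ₀ h2 hσ₀) :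
    Summit.BirchSwinnertonDyer.Rank1Residual.X12.CMAtTwo :=
  cmAtTwo_of_lower_of_publishedFactsTwoPlus_of_named (SylvesterTwoHandItemResiduals.heegnerIndexLowerAtTwoHSY_of_facts_of_onV0_of_offV0 hF.1 hon hoff)
    hF hG3' hD hES2 hVII

end Summit.BirchSwinnertonDyer.BirchSwinnertonDyer.Theorems.SylvesterTwoLowerAsideTwin

end
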